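import Summits.CriticalPhenomena.PercolationContinuityZ3.Theorems.Transplant.FKConnectivityAllQForestHubPairDecomposition
import HarnessLib

/-!
# THE LAST FREE PAIR of a first-class path into a pinned class: bridges, sides, existence and uniqueness; fibre counts along a partition

Support file (`--supports stmt-CriticalPhenomena-4575`), FK sub-lane `prim-bschramm-fk-1` (gen 26) of the post-continuity programme;
builds on p205010 (kernel theorem, internal audit signed; external expert review pending).  No definitions, no named facts, no sorries;
standard axioms.  Part 1 of 2 (part 2: `…ForestHubPairLastEdge`, the node `HubPairLastEdgeOn` and the arrow to (★) / to the square-free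
adjacent forest Rayleigh node).

SETTING (memo bschramm/FROM-fk-1-g26-LAST-EDGE.md).  A configuration `ω` of the fibre `(M, u₀)` contains the pinned pairs `u₀` and is
contained in `M ∪ u₀`; write `[a]` for the pinned class of `a` (the vertices joined to `a` by pinned pairs).  If `ω` is a forest
configuration joining `o` to `a` while `o ∉ [a]`, the `ω`-path from `o` to `[a]` ends with a unique FREE pair `g = s(x, a')` with
`a' ∈ [a]`, `x ∉ [a]` and `x` still joined to `o` in `ω ∖ {g}` — the LAST FREE PAIR.  This file proves exactly that, by reachability
algebra (no path bookkeeping beyond Mathlib's `Walk.exists_boundary_dart`):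
* `not_reachable_sdiff_of_mem_forest` — a pair of a forest configuration is a bridge;
* `reachable_sdiff_pair_of_walk`, `reachable_sdiff_of_not_reachable` — deleting a pair with an endpoint outside the cluster of `o`
  keeps the cluster of `o`;
* `bridge_endpoints`, `sides_of_bridge` — a pair whose deletion separates `o` from `a` has one endpoint on each side;
* **`exists_last_free_pair`** (strong induction on `|ω|`, through `exists_last_free_pair_step`) and **`last_free_pair_unique`**;
* **`fibreCount_eq_sum_of_partition`** — a fibre count is the sum of its restrictions to events that partition the configurations it
  counts (`Finset.card_biUnion`).
Part 2 sums the one-class hub-pair counts of (★) over the last free pair.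
[cite: Grimmett2006, §1.5 (p. 13)] [cite: Linusson2011, Prop. 2.6] [cite: SempleWelsh2008, Conj. 1.1 (p. 2)]
-/

noncomputable section

namespace Summit.CriticalPhenomena.PercolationContinuityZ3.Theorems
namespace FK

open Set Literature.Probability.LatticeModels Literature.Probability.Percolation
open scoped Classical symmDiff

variable {V : Type*} [Fintype V]

/-! ### Reachability tools: bridges of a forest configuration -/

section Reach

variable {ω : BondConfig V} {o x w a p q : V}

omit [Fintype V] in
/-- **A pair of a forest configuration is a bridge**: deleting `s(x,w) ∈ ω` separates `x` from `w`. [cite: Grimmett2006, §1.5 (p. 13)] -/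
theorem not_reachable_sdiff_of_mem_forest (hF : IsForestCfg ω) (hxw : x ≠ w) (hg : s(x, w) ∈ ω) :
    ¬ (openGraph (ω \ {s(x, w)})).Reachable x w := by
  have hback : insert s(x, w) (ω \ {s(x, w)}) = ω := by rw [insert_sdiff_singleton, insert_eq_of_mem hg]
  have hF' : IsForestCfg (insert s(x, w) (ω \ {s(x, w)})) := by rw [hback]; exact hF
  exact ((isForestCfg_insert_iff hxw (fun h => h.2 rfl)).1 hF').2

omit [Fintype V] in
/-- Walk form of `reachable_sdiff_of_not_reachable`. [folklore] -/
theorem reachable_sdiff_pair_of_walk {b : V} (W : (openGraph ω).Walk b p) :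
    ¬ (openGraph ω).Reachable b x → (openGraph (ω \ {s(x, w)})).Reachable b p := by
  induction W with
  | nil => exact fun _ => SimpleGraph.Reachable.refl _
  | cons hadj W' ih =>
    rename_i b c _
    intro hbx
    have hbc := (openGraph_adj ω b c).1 hadj
    have hcx : ¬ (openGraph ω).Reachable c x := fun h => hbx (hadj.reachable.trans h)
    have hne : s(b, c) ≠ s(x, w) := by
      intro h'
      rcases Sym2.eq_iff.1 h' with ⟨hb, _⟩ | ⟨_, hc⟩
      · exact hbx (hb ▸ SimpleGraph.Reachable.refl _)
      · exact hcx (hc ▸ SimpleGraph.Reachable.refl _)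
    have hstep : (openGraph (ω \ {s(x, w)})).Adj b c := (openGraph_adj (ω \ {s(x, w)}) b c).2 ⟨⟨hbc.1, hne⟩, hbc.2⟩
    exact hstep.reachable.trans (ih hcx)

omit [Fintype V] in
/-- **Deleting a pair with an endpoint outside the cluster of `o` does not shrink the cluster of `o`.** [folklore] -/
theorem reachable_sdiff_of_not_reachable (hop : (openGraph ω).Reachable o p) (hox : ¬ (openGraph ω).Reachable o x) (w : V) :
    (openGraph (ω \ {s(x, w)})).Reachable o p := by
  obtain ⟨W⟩ := hop
  exact reachable_sdiff_pair_of_walk W hox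

omit [Fintype V] in
/-- A boundary dart of an `ω`-walk leaving the `ω ∖ {g}`-cluster of its start is the pair `g = s(p,q)`: one endpoint of `g` is in the
cluster, the other is not. [folklore] -/
theorem bridge_endpoints {b c : V} (hbc : ¬ (openGraph (ω \ {s(p, q)})).Reachable b c) (hw : (openGraph ω).Reachable b c) :
    ((openGraph (ω \ {s(p, q)})).Reachable b p ∧ ¬ (openGraph (ω \ {s(p, q)})).Reachable b q) ∨
      ((openGraph (ω \ {s(p, q)})).Reachable b q ∧ ¬ (openGraph (ω \ {s(p, q)})).Reachable b p) := by
  obtain ⟨W⟩ := hw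
  have hbS : b ∈ {z | (openGraph (ω \ {s(p, q)})).Reachable b z} := SimpleGraph.Reachable.refl _
  have hcS : c ∉ {z | (openGraph (ω \ {s(p, q)})).Reachable b z} := hbc
  obtain ⟨d, -, hd1, hd2⟩ := W.exists_boundary_dart {z | (openGraph (ω \ {s(p, q)})).Reachable b z} hbS hcS
  simp only [mem_setOf_eq] at hd1 hd2
  have hadj := (openGraph_adj ω d.fst d.snd).1 d.adj
  have hedge : s(d.fst, d.snd) = s(p, q) := by
    by_contra hne
    exact hd2 (hd1.trans ((openGraph_adj (ω \ {s(p, q)}) d.fst d.snd).2 ⟨⟨hadj.1, hne⟩, hadj.2⟩).reachable)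
  rcases Sym2.eq_iff.1 hedge with ⟨h1, h2⟩ | ⟨h1, h2⟩
  · exact Or.inl ⟨h1 ▸ hd1, h2 ▸ hd2⟩
  · exact Or.inr ⟨h1 ▸ hd1, h2 ▸ hd2⟩

omit [Fintype V] in
/-- **The two sides of a separating pair**: if `o ~ a` in `ω` but not in `ω ∖ {g}`, `g = s(p,q)`, then one endpoint of `g` lies in
the `ω ∖ {g}`-cluster of `o` and the other in that of `a`. [folklore] -/
theorem sides_of_bridge (hoa : (openGraph ω).Reachable o a) (hnot : ¬ (openGraph (ω \ {s(p, q)})).Reachable o a) :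
    ((openGraph (ω \ {s(p, q)})).Reachable o p ∧ (openGraph (ω \ {s(p, q)})).Reachable q a) ∨
      ((openGraph (ω \ {s(p, q)})).Reachable o q ∧ (openGraph (ω \ {s(p, q)})).Reachable p a) := by
  have hsymm : ¬ (openGraph (ω \ {s(p, q)})).Reachable a o := fun h => hnot h.symm
  rcases bridge_endpoints hnot hoa with ⟨hop, hoq⟩ | ⟨hoq, hop⟩
  · rcases bridge_endpoints hsymm hoa.symm with ⟨hap, _⟩ | ⟨haq, _⟩
    · exact absurd (hop.trans hap.symm) hnot
    · exact Or.inl ⟨hop, haq.symm⟩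
  · rcases bridge_endpoints hsymm hoa.symm with ⟨hap, _⟩ | ⟨haq, _⟩
    · exact Or.inr ⟨hoq, hap.symm⟩
    · exact absurd (hoq.trans haq.symm) hnot

end Reach

/-! ### The last free pair of the first-class path from `o` to the pinned class of `a` -/

section LastPair

variable {M u₀ : BondConfig V} {a : V}

omit [Fintype V] in
/-- One step of `exists_last_free_pair`: a free pair `g = s(p,q) ∈ ω` separating `o` from `a`, with `o` on the side of `p`.
[cite: Grimmett2006, §1.5 (p. 13)] -/
theorem exists_last_free_pair_step {ω : BondConfig V} {o p q : V}
    (IH : ∀ (o' : V), (openGraph (ω \ {s(p, q)})).Reachable o' a → ¬ (openGraph u₀).Reachable o' a →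
      ∃ x a', s(x, a') ∈ ω \ {s(p, q)} ∧ s(x, a') ∈ M ∧ (openGraph u₀).Reachable a a' ∧ ¬ (openGraph u₀).Reachable a x ∧
        (openGraph ((ω \ {s(p, q)}) \ {s(x, a')})).Reachable o' x)
    (hsub : u₀ ⊆ ω) (hg : s(p, q) ∈ ω) (hgM : s(p, q) ∈ M) (hgu : s(p, q) ∉ u₀) (hpq : p ≠ q)
    (hop : (openGraph (ω \ {s(p, q)})).Reachable o p) (hqa : (openGraph (ω \ {s(p, q)})).Reachable q a)
    (hpa : ¬ (openGraph (ω \ {s(p, q)})).Reachable o a) :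
    ∃ x a', s(x, a') ∈ ω ∧ s(x, a') ∈ M ∧ (openGraph u₀).Reachable a a' ∧ ¬ (openGraph u₀).Reachable a x ∧
      (openGraph (ω \ {s(x, a')})).Reachable o x := by
  have hsub' : u₀ ⊆ ω \ {s(p, q)} := fun r hr => ⟨hsub hr, fun h => hgu (mem_singleton_iff.1 h ▸ hr)⟩
  by_cases hq : (openGraph u₀).Reachable a q
  · -- `g` itself is the last free pair
    refine ⟨p, q, hg, hgM, hq, fun hap => hpa ?_, hop⟩
    exact hop.trans ((hap.mono (openGraph_mono hsub')).symm.trans (SimpleGraph.Reachable.refl a))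
  · -- continue from `q` inside `ω ∖ {g}`
    obtain ⟨x, a', hxω, hxM, haa', hax, hqx⟩ := IH q hqa (fun h => hq h.symm)
    have hne : s(x, a') ≠ s(p, q) := fun h => hxω.2 (mem_singleton_iff.2 h)
    refine ⟨x, a', hxω.1, hxM, haa', hax, ?_⟩
    -- `o ~ p` avoiding `g` and `s(x,a')`: `x` is not in the `ω ∖ {g}`-cluster of `o`
    have hox : ¬ (openGraph (ω \ {s(p, q)})).Reachable o x := fun h =>
      hpa (h.trans ((hqx.mono (openGraph_mono Set.sdiff_subset)).symm.trans hqa))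
    have h1 : (openGraph ((ω \ {s(p, q)}) \ {s(x, a')})).Reachable o p := reachable_sdiff_of_not_reachable hop hox a'
    have hmono : (ω \ {s(p, q)}) \ {s(x, a')} ⊆ ω \ {s(x, a')} := Set.sdiff_subset_sdiff_left Set.sdiff_subset
    have h2 : (openGraph (ω \ {s(x, a')})).Adj p q := (openGraph_adj _ p q).2 ⟨⟨hg, fun h => hne (mem_singleton_iff.1 h).symm⟩, hpq⟩
    exact ((h1.mono (openGraph_mono hmono)).trans h2.reachable).trans (hqx.mono (openGraph_mono hmono))

/-- **Existence of the last free pair.**  If `u₀ ⊆ ω ⊆ M ∪ u₀`, `ω` is a forest configuration, `a` is reachable from `o` in `ω`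
but not by pinned pairs alone, then some free pair `g = s(x, a') ∈ ω ∩ M` has `a'` in the pinned class of `a`, `x` outside it, and
`x` reachable from `o` in `ω ∖ {g}`. [cite: Grimmett2006, §1.5 (p. 13)] -/
theorem exists_last_free_pair : ∀ (k : ℕ) (ω : BondConfig V) (o : V), ω.ncard = k → u₀ ⊆ ω → ω ⊆ M ∪ u₀ → IsForestCfg ω →
    (openGraph ω).Reachable o a → ¬ (openGraph u₀).Reachable o a →
    ∃ x a', s(x, a') ∈ ω ∧ s(x, a') ∈ M ∧ (openGraph u₀).Reachable a a' ∧ ¬ (openGraph u₀).Reachable a x ∧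
      (openGraph (ω \ {s(x, a')})).Reachable o x := by
  intro k
  induction k using Nat.strong_induction_on with
  | _ k ih =>
    intro ω o hk hsub hωM hF hoa hnot
    -- a free pair of `ω`
    have hex : ∃ g ∈ ω, g ∉ u₀ := by
      by_contra hall
      push Not at hall
      exact hnot (hoa.mono (openGraph_mono fun r hr => hall r hr))
    obtain ⟨g, hgω, hgu⟩ := hex
    have hgM : g ∈ M := (hωM hgω).resolve_right hgu
    induction g using Sym2.ind with
    | _ p q =>
      have hpq : p ≠ q := fun h => hF.1 _ hgω (Sym2.mk_isDiag_iff.2 h)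
      have hlt : (ω \ {s(p, q)}).ncard < k := by rw [← hk]; exact Set.ncard_sdiff_singleton_lt_of_mem hgω
      have hsub' : u₀ ⊆ ω \ {s(p, q)} := fun r hr => ⟨hsub hr, fun h => hgu (mem_singleton_iff.1 h ▸ hr)⟩
      have hωM' : ω \ {s(p, q)} ⊆ M ∪ u₀ := fun r hr => hωM hr.1
      have hF' : IsForestCfg (ω \ {s(p, q)}) := isForestCfg_of_subset hF Set.sdiff_subset
      have IH' : ∀ (o' : V), (openGraph (ω \ {s(p, q)})).Reachable o' a → ¬ (openGraph u₀).Reachable o' a →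
          ∃ x a', s(x, a') ∈ ω \ {s(p, q)} ∧ s(x, a') ∈ M ∧ (openGraph u₀).Reachable a a' ∧ ¬ (openGraph u₀).Reachable a x ∧
            (openGraph ((ω \ {s(p, q)}) \ {s(x, a')})).Reachable o' x :=
        fun o' h1 h2 => ih _ hlt (ω \ {s(p, q)}) o' rfl hsub' hωM' hF' h1 h2
      by_cases hpa : (openGraph (ω \ {s(p, q)})).Reachable o a
      · obtain ⟨x, a', hxω, hxM, haa', hax, hox⟩ := IH' o hpa hnot
        exact ⟨x, a', hxω.1, hxM, haa', hax, hox.mono (openGraph_mono (Set.sdiff_subset_sdiff_left Set.sdiff_subset))⟩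
      · rcases sides_of_bridge hoa hpa with ⟨hop, hqa⟩ | ⟨hoq, hpa'⟩
        · exact exists_last_free_pair_step IH' hsub hgω hgM hgu hpq hop hqa hpa
        · have hg' : s(q, p) = s(p, q) := Sym2.eq_swap
          have IH'' : ∀ (o' : V), (openGraph (ω \ {s(q, p)})).Reachable o' a → ¬ (openGraph u₀).Reachable o' a →
              ∃ x a', s(x, a') ∈ ω \ {s(q, p)} ∧ s(x, a') ∈ M ∧ (openGraph u₀).Reachable a a' ∧ ¬ (openGraph u₀).Reachable a x ∧
                (openGraph ((ω \ {s(q, p)}) \ {s(x, a')})).Reachable o' x := by rw [hg']; exact IH'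
          rw [← hg'] at hoq hpa' hpa
          exact exists_last_free_pair_step IH'' hsub (hg' ▸ hgω) (hg' ▸ hgM) (hg' ▸ hgu) hpq.symm hoq hpa' hpa

omit [Fintype V] in
/-- **Uniqueness of the last free pair**: two pairs `s(x_i, a_i) ∈ ω` with `a_i` in the pinned class of `a`, `x_i` outside it and
`x_i` reachable from `o` in `ω ∖ {s(x_i, a_i)}` coincide (as ordered pairs). [cite: Grimmett2006, §1.5 (p. 13)] -/
theorem last_free_pair_unique {ω : BondConfig V} {o x₁ a₁ x₂ a₂ : V} (hsub : u₀ ⊆ ω) (hF : IsForestCfg ω)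
    (h₁ : s(x₁, a₁) ∈ ω) (h₂ : s(x₂, a₂) ∈ ω) (ha₁ : (openGraph u₀).Reachable a a₁) (ha₂ : (openGraph u₀).Reachable a a₂)
    (hx₁ : ¬ (openGraph u₀).Reachable a x₁) (hx₂ : ¬ (openGraph u₀).Reachable a x₂)
    (hr₁ : (openGraph (ω \ {s(x₁, a₁)})).Reachable o x₁) (hr₂ : (openGraph (ω \ {s(x₂, a₂)})).Reachable o x₂) :
    x₁ = x₂ ∧ a₁ = a₂ := by
  have hne₁ : x₁ ≠ a₁ := fun h => hx₁ (h ▸ ha₁)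
  have hne₂ : x₂ ≠ a₂ := fun h => hx₂ (h ▸ ha₂)
  have hb₁ := not_reachable_sdiff_of_mem_forest hF hne₁ h₁
  have hb₂ := not_reachable_sdiff_of_mem_forest hF hne₂ h₂
  have hsub₁ : u₀ ⊆ ω \ {s(x₁, a₁)} := fun r hr => ⟨hsub hr, fun h => hx₁ ?_⟩
  swap
  · -- a pinned pair equal to `s(x₁,a₁)` would put `x₁` in the pinned class of `a`
    have hr' : s(x₁, a₁) ∈ u₀ := mem_singleton_iff.1 h ▸ hr
    exact ha₁.trans ((openGraph_adj u₀ a₁ x₁).2 ⟨Sym2.eq_swap ▸ hr', hne₁.symm⟩).reachable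
  have hsub₂ : u₀ ⊆ ω \ {s(x₂, a₂)} := fun r hr => ⟨hsub hr, fun h => hx₂ ?_⟩
  swap
  · have hr' : s(x₂, a₂) ∈ u₀ := mem_singleton_iff.1 h ▸ hr
    exact ha₂.trans ((openGraph_adj u₀ a₂ x₂).2 ⟨Sym2.eq_swap ▸ hr', hne₂.symm⟩).reachable
  -- `a` is cut from `o` by each pair
  have hA₁ : ¬ (openGraph (ω \ {s(x₁, a₁)})).Reachable o a := fun h =>
    hb₁ (hr₁.symm.trans (h.trans (ha₁.mono (openGraph_mono hsub₁))))
  have hA₂ : ¬ (openGraph (ω \ {s(x₂, a₂)})).Reachable o a := fun h =>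
    hb₂ (hr₂.symm.trans (h.trans (ha₂.mono (openGraph_mono hsub₂))))
  by_cases hg : s(x₁, a₁) = s(x₂, a₂)
  · rcases Sym2.eq_iff.1 hg with ⟨h1, h2⟩ | ⟨h1, h2⟩
    · exact ⟨h1, h2⟩
    · exact absurd (h1 ▸ ha₂ : (openGraph u₀).Reachable a x₁) hx₁
  · exfalso
    -- `x₂` is not in the `ω ∖ {g₁}`-cluster of `o`, and symmetrically
    have hx₂' : ¬ (openGraph (ω \ {s(x₁, a₁)})).Reachable o x₂ := by
      intro h
      have hadj : (openGraph (ω \ {s(x₁, a₁)})).Adj x₂ a₂ :=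
        (openGraph_adj _ x₂ a₂).2 ⟨⟨h₂, fun h' => hg (mem_singleton_iff.1 h').symm⟩, hne₂⟩
      exact hA₁ ((h.trans hadj.reachable).trans (ha₂.mono (openGraph_mono hsub₁)).symm)
    have hx₁' : ¬ (openGraph (ω \ {s(x₂, a₂)})).Reachable o x₁ := by
      intro h
      have hadj : (openGraph (ω \ {s(x₂, a₂)})).Adj x₁ a₁ :=
        (openGraph_adj _ x₁ a₁).2 ⟨⟨h₁, fun h' => hg (mem_singleton_iff.1 h')⟩, hne₁⟩
      exact hA₂ ((h.trans hadj.reachable).trans (ha₁.mono (openGraph_mono hsub₂)).symm)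
    have h3 := reachable_sdiff_of_not_reachable hr₂ hx₁' a₁
    exact hx₂' (h3.mono (openGraph_mono (Set.sdiff_subset_sdiff_left Set.sdiff_subset)))

end LastPair

/-! ### Fibre counts split along a partition of the fibre -/

/-- **A fibre count splits along events that partition the configurations it counts.** [cite: Linusson2011, Prop. 2.6] -/
theorem fibreCount_eq_sum_of_partition {ι : Type*} (I : Finset ι) (L : ι → Set (BondConfig V)) (M u : BondConfig V)
    (A B : Set (BondConfig V)) (hcover : ∀ ω : BondConfig V, ω \ M = u → ω ∈ A → ω ∆ M ∈ B → ∃ i ∈ I, ω ∈ L i)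
    (huniq : ∀ ω : BondConfig V, ω \ M = u → ω ∈ A → ω ∆ M ∈ B → ∀ i ∈ I, ∀ j ∈ I, ω ∈ L i → ω ∈ L j → i = j) :
    fibreCount M u A B = ∑ i ∈ I, fibreCount M u (A ∩ L i) B := by
  unfold fibreCount
  rw [eq_comm]
  refine (Finset.card_biUnion ?_).symm.trans ?_
  · intro i hi j hj hij
    change Disjoint _ _
    rw [Finset.disjoint_left]
    intro ω hωi hωj
    simp only [Finset.mem_filter, Finset.mem_univ, true_and, mem_inter_iff] at hωi hωj
    exact hij (huniq ω hωi.1 hωi.2.1.1 hωi.2.2 i hi j hj hωi.2.1.2 hωj.2.1.2)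
  · congr 1
    ext ω
    simp only [Finset.mem_filter, Finset.mem_univ, true_and, Finset.mem_biUnion, mem_inter_iff]
    constructor
    · rintro ⟨i, -, h1, ⟨h2, -⟩, h3⟩
      exact ⟨h1, h2, h3⟩
    · rintro ⟨h1, h2, h3⟩
      obtain ⟨i, hi, hL⟩ := hcover ω h1 h2 h3
      exact ⟨i, hi, h1, ⟨h2, hL⟩, h3⟩


end FK
end Summit.CriticalPhenomena.PercolationContinuityZ3.Theorems

end
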